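import Mathlib.Analysis.SpecialFunctions.SmoothTransition
import HarnessLib

/-!
# K1loc, line `Spectral` / SeqCone — helper: THE CONCRETE CONE–RADIAL SYMBOLS ON THE LATTICE (S-B symbol data, lattice side)

Helper file of the prover lane on the crux `K1LocalisedCascade` (stmt-AnomalousDissipation-19491), route
`SawtoothPulseCascade` (memo v6 §2 / §4 "S-B SymbolData"; glue seat k1loc-p3).  The symbol compatibilities
`…K1Symbol.compat_H`, `compat_V`, `compat_env` (file `…SymbolCone`) are stated for ARBITRARY `[0,1]`-valued good-region
indicators `g^S`, `g^M`, `g^env` on `ℤ × ℤ` with prescribed support / equal-to-one regions.  This file supplies one concrete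
smooth family and proves exactly those hypotheses (`hS0/hS1`, `hS_supp`, `hS_one`, `hM0/hM1`, `hM_supp`, `hM_one`,
`hg_supp`, `hg'_one`).  With `sT = Real.smoothTransition` (`0` on `(−∞,0]`, `1` on `[1,∞)`), widths `ε, ε_a > 0`, apertures
`a, a₂` and radius `L` (all casts `ℤ → ℝ`):
* radial cut-off `ψ_L(s) = sT((|s| − L)/(εL))` (`0` for `|s| ≤ L`, `1` for `|s| ≥ (1+ε)L`);
* start-of-phase symbol `g^S_L(k_h,k_v) = ψ_L(k_h)·(1 − sT((γ|k_v| − a|k_h|)/(ε_a L)))`;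
* mid-phase symbol `g^M_{L₀}(k_h,k_v) = ψ_{L₀}(k_h)·(1 − sT((γ|k_v + γk_h| − a₂|k_h|)/(ε_a L₀))·sT((γ|k_v − γk_h| − a₂|k_h|)/(ε_a L₀)))`
  (product form: values in `[0,1]` with no disjointness argument; in the assembly `L₀ = L/(1+ε)`);
* envelope `g^env_{R,w}(k_a,k_c) = (1 − sT((|k_a| − R)/w))·(1 − sT((|k_c| − R)/w))`.
DESIGN (vs memo v6 §2): the cone transition widths are ADDITIVE (`ε_a·L`, not `ε_a·|k_h|`), so that every fibre
restriction is locally an affine smooth step (fibre Taylor data in the companion file `…SymbolFibreData`); on the support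
of `ψ_L` one has `|k_h| > L`, so the additive width is at most the relative one and the support apertures are `a + ε_a`,
`a₂ + ε_a`.  Results: `symS_nonneg/le_one/supp/eq_one`, `symM_nonneg/le_one/supp/eq_one`, `symEnv_nonneg/le_one/supp/eq_one`,
`abs_one_sub_le_one`.  No definitions; no statement about the stub.
[cite: ElgindiLissMattingly2025, §1.2.2 (the cones C_u, C_s) and §3.1 Lemma 3.1] [problem: turb]
-/

-- `Summit.<Summit>.<Problem>`: single-conjunct summit, the duplicate namespace segment is deliberate.
set_option linter.dupNamespace false

noncomputable section

namespace Summit.AnomalousDissipation.AnomalousDissipation.Theorems.SawtoothPulseCascade.K1Symbol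

open Real

/-! ## Elementary facts on the smooth transition -/

/-- `sT x ≠ 0 ⇒ 0 < x`. [folklore] -/
theorem pos_of_smoothTransition_ne_zero {x : ℝ} (h : smoothTransition x ≠ 0) : 0 < x :=
  not_le.mp fun hx => h (Real.smoothTransition.zero_of_nonpos hx)

/-- `sT x ≠ 1 ⇒ x < 1`. [folklore] -/
theorem lt_one_of_smoothTransition_ne_one {x : ℝ} (h : smoothTransition x ≠ 1) : x < 1 :=
  not_le.mp fun hx => h (Real.smoothTransition.one_of_one_le hx)

/-- `0 ≤ 1 − sT x`. [folklore] -/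
theorem one_sub_smoothTransition_nonneg (x : ℝ) : 0 ≤ 1 - smoothTransition x :=
  sub_nonneg.mpr (Real.smoothTransition.le_one x)

/-- `1 − sT x ≤ 1`. [folklore] -/
theorem one_sub_smoothTransition_le_one (x : ℝ) : 1 - smoothTransition x ≤ 1 :=
  sub_le_self _ (Real.smoothTransition.nonneg x)

/-- `|1 − g| ≤ 1` for `g ∈ [0,1]` (the form `hμ1 : |μ| ≤ 1` of the half-slot machine for `μ = 1 − g`). [folklore] -/
theorem abs_one_sub_le_one {x : ℝ} (h0 : 0 ≤ x) (h1 : x ≤ 1) : |1 - x| ≤ 1 :=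
  abs_le.mpr ⟨by linarith, by linarith⟩

/-- The radial cut-off is non-zero only beyond the radius: `sT((|s| − L)/(εL)) ≠ 0 ⇒ L < |s|` (`ε, L > 0`). [folklore] -/
theorem lt_abs_of_radial_ne_zero {ε L s : ℝ} (hε : 0 < ε) (hL : 0 < L)
    (h : smoothTransition ((|s| - L) / (ε * L)) ≠ 0) : L < |s| := by
  have := pos_of_smoothTransition_ne_zero h
  rw [div_pos_iff_of_pos_right (mul_pos hε hL)] at this
  linarith

/-- The radial cut-off equals one beyond `(1+ε)L`: `(1+ε)L ≤ |s| ⇒ sT((|s| − L)/(εL)) = 1` (`ε, L > 0`). [folklore] -/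
theorem radial_eq_one {ε L s : ℝ} (hε : 0 < ε) (hL : 0 < L) (h : (1 + ε) * L ≤ |s|) :
    smoothTransition ((|s| - L) / (ε * L)) = 1 :=
  Real.smoothTransition.one_of_one_le ((one_le_div (mul_pos hε hL)).mpr (by linarith))

/-! ## The start-of-phase symbol `g^S` -/

/-- `0 ≤ g^S`. [folklore] -/
theorem symS_nonneg (γ ε εa a L : ℝ) (kh kv : ℤ) :
    0 ≤ smoothTransition ((|(kh : ℝ)| - L) / (ε * L)) *
      (1 - smoothTransition ((γ * |(kv : ℝ)| - a * |(kh : ℝ)|) / (εa * L))) :=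
  mul_nonneg (Real.smoothTransition.nonneg _) (one_sub_smoothTransition_nonneg _)

/-- `g^S ≤ 1`. [folklore] -/
theorem symS_le_one (γ ε εa a L : ℝ) (kh kv : ℤ) :
    smoothTransition ((|(kh : ℝ)| - L) / (ε * L)) *
      (1 - smoothTransition ((γ * |(kv : ℝ)| - a * |(kh : ℝ)|) / (εa * L))) ≤ 1 :=
  mul_le_one₀ (Real.smoothTransition.le_one _) (one_sub_smoothTransition_nonneg _) (one_sub_smoothTransition_le_one _)

/-- **Support of `g^S`** (hypothesis `hS_supp` of `compat_H` with `a' = a + ε_a`): `g^S(k) ≠ 0 ⇒ |k_h| > L` and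
`γ|k_v| < (a + ε_a)|k_h|` (`ε, ε_a, L > 0`). [cite: ElgindiLissMattingly2025, §1.2.2 (the unstable cone)] -/
theorem symS_supp {γ ε εa a L : ℝ} (hε : 0 < ε) (hεa : 0 < εa) (hL : 0 < L) (kh kv : ℤ)
    (h : smoothTransition ((|(kh : ℝ)| - L) / (ε * L)) *
      (1 - smoothTransition ((γ * |(kv : ℝ)| - a * |(kh : ℝ)|) / (εa * L))) ≠ 0) :
    L < |(kh : ℝ)| ∧ γ * |(kv : ℝ)| < (a + εa) * |(kh : ℝ)| := by
  obtain ⟨h1, h2⟩ := mul_ne_zero_iff.mp h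
  have hkh := lt_abs_of_radial_ne_zero hε hL h1
  refine ⟨hkh, ?_⟩
  have h3 := lt_one_of_smoothTransition_ne_one (sub_ne_zero.mp h2).symm
  rw [div_lt_one (mul_pos hεa hL)] at h3
  nlinarith

/-- **`g^S = 1` deep inside the region** (hypothesis `hS_one` of `compat_V` with `L' = (1+ε)L`): `|k_h| ≥ (1+ε)L` and
`γ|k_v| ≤ a|k_h|` give `g^S(k) = 1` (`ε, ε_a, L > 0`). [cite: ElgindiLissMattingly2025, §1.2.2 (the unstable cone)] -/
theorem symS_eq_one {γ ε εa a L : ℝ} (hε : 0 < ε) (hεa : 0 < εa) (hL : 0 < L) (kh kv : ℤ)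
    (hkh : (1 + ε) * L ≤ |(kh : ℝ)|) (hkv : γ * |(kv : ℝ)| ≤ a * |(kh : ℝ)|) :
    smoothTransition ((|(kh : ℝ)| - L) / (ε * L)) *
      (1 - smoothTransition ((γ * |(kv : ℝ)| - a * |(kh : ℝ)|) / (εa * L))) = 1 := by
  rw [radial_eq_one hε hL hkh, one_mul, Real.smoothTransition.zero_of_nonpos, sub_zero]
  exact div_nonpos_of_nonpos_of_nonneg (by linarith) (mul_pos hεa hL).le

/-! ## The mid-phase symbol `g^M` -/

/-- `0 ≤ g^M`. [folklore] -/
theorem symM_nonneg (γ ε εa a₂ L₀ : ℝ) (kh kv : ℤ) :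
    0 ≤ smoothTransition ((|(kh : ℝ)| - L₀) / (ε * L₀)) *
      (1 - smoothTransition ((γ * |(kv : ℝ) + γ * kh| - a₂ * |(kh : ℝ)|) / (εa * L₀)) *
        smoothTransition ((γ * |(kv : ℝ) - γ * kh| - a₂ * |(kh : ℝ)|) / (εa * L₀))) :=
  mul_nonneg (Real.smoothTransition.nonneg _) (sub_nonneg.mpr
    (mul_le_one₀ (Real.smoothTransition.le_one _) (Real.smoothTransition.nonneg _) (Real.smoothTransition.le_one _)))

/-- `g^M ≤ 1`. [folklore] -/
theorem symM_le_one (γ ε εa a₂ L₀ : ℝ) (kh kv : ℤ) :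
    smoothTransition ((|(kh : ℝ)| - L₀) / (ε * L₀)) *
      (1 - smoothTransition ((γ * |(kv : ℝ) + γ * kh| - a₂ * |(kh : ℝ)|) / (εa * L₀)) *
        smoothTransition ((γ * |(kv : ℝ) - γ * kh| - a₂ * |(kh : ℝ)|) / (εa * L₀))) ≤ 1 :=
  mul_le_one₀ (Real.smoothTransition.le_one _) (sub_nonneg.mpr
    (mul_le_one₀ (Real.smoothTransition.le_one _) (Real.smoothTransition.nonneg _) (Real.smoothTransition.le_one _)))
    (sub_le_self _ (mul_nonneg (Real.smoothTransition.nonneg _) (Real.smoothTransition.nonneg _)))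

/-- **Support of `g^M`** (hypothesis `hM_supp` of `compat_V` with `a' = a₂ + ε_a`): `g^M(k) ≠ 0 ⇒ |k_h| > L₀` and
`γ|k_v + σγk_h| < (a₂ + ε_a)|k_h|` for some `σ = ±1` (`ε, ε_a, L₀ > 0`).
[cite: ElgindiLissMattingly2025, §1.2.2 (cones and cocycle)] -/
theorem symM_supp {γ ε εa a₂ L₀ : ℝ} (hε : 0 < ε) (hεa : 0 < εa) (hL₀ : 0 < L₀) (kh kv : ℤ)
    (h : smoothTransition ((|(kh : ℝ)| - L₀) / (ε * L₀)) *
      (1 - smoothTransition ((γ * |(kv : ℝ) + γ * kh| - a₂ * |(kh : ℝ)|) / (εa * L₀)) *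
        smoothTransition ((γ * |(kv : ℝ) - γ * kh| - a₂ * |(kh : ℝ)|) / (εa * L₀))) ≠ 0) :
    L₀ < |(kh : ℝ)| ∧ ∃ σ : ℝ, (σ = 1 ∨ σ = -1) ∧ γ * |(kv : ℝ) + σ * γ * kh| < (a₂ + εa) * |(kh : ℝ)| := by
  obtain ⟨h1, h2⟩ := mul_ne_zero_iff.mp h
  have hkh := lt_abs_of_radial_ne_zero hε hL₀ h1
  refine ⟨hkh, ?_⟩
  have h3 : smoothTransition ((γ * |(kv : ℝ) + γ * kh| - a₂ * |(kh : ℝ)|) / (εa * L₀)) *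
      smoothTransition ((γ * |(kv : ℝ) - γ * kh| - a₂ * |(kh : ℝ)|) / (εa * L₀)) ≠ 1 := fun h' => h2 (by rw [h', sub_self])
  -- one of the two factors is `< 1`
  by_cases hp : smoothTransition ((γ * |(kv : ℝ) + γ * kh| - a₂ * |(kh : ℝ)|) / (εa * L₀)) = 1
  · rw [hp, one_mul] at h3
    have h4 := lt_one_of_smoothTransition_ne_one h3
    rw [div_lt_one (mul_pos hεa hL₀)] at h4
    refine ⟨-1, Or.inr rfl, ?_⟩
    rw [show (kv : ℝ) + -1 * γ * kh = kv - γ * kh by ring]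
    nlinarith
  · have h4 := lt_one_of_smoothTransition_ne_one hp
    rw [div_lt_one (mul_pos hεa hL₀)] at h4
    refine ⟨1, Or.inl rfl, ?_⟩
    rw [show (kv : ℝ) + 1 * γ * kh = kv + γ * kh by ring]
    nlinarith

/-- **`g^M = 1` on the mid-phase region** (hypothesis `hM_one` of `compat_H` with `L = (1+ε)L₀`): `|k_h| ≥ (1+ε)L₀` and
`γ|k_v + σγk_h| ≤ a₂|k_h|` for some `σ = ±1` give `g^M(k) = 1` (`ε, ε_a, L₀ > 0`).
[cite: ElgindiLissMattingly2025, §1.2.2 (cones and cocycle)] -/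
theorem symM_eq_one {γ ε εa a₂ L₀ : ℝ} (hε : 0 < ε) (hεa : 0 < εa) (hL₀ : 0 < L₀) (kh kv : ℤ) {σ : ℝ}
    (hσ : σ = 1 ∨ σ = -1) (hkh : (1 + ε) * L₀ ≤ |(kh : ℝ)|) (hkv : γ * |(kv : ℝ) + σ * γ * kh| ≤ a₂ * |(kh : ℝ)|) :
    smoothTransition ((|(kh : ℝ)| - L₀) / (ε * L₀)) *
      (1 - smoothTransition ((γ * |(kv : ℝ) + γ * kh| - a₂ * |(kh : ℝ)|) / (εa * L₀)) *
        smoothTransition ((γ * |(kv : ℝ) - γ * kh| - a₂ * |(kh : ℝ)|) / (εa * L₀))) = 1 := by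
  rw [radial_eq_one hε hL₀ hkh, one_mul, sub_eq_self]
  rcases hσ with rfl | rfl
  · rw [one_mul] at hkv
    rw [Real.smoothTransition.zero_of_nonpos (div_nonpos_of_nonpos_of_nonneg (by linarith) (mul_pos hεa hL₀).le), zero_mul]
  · rw [show (kv : ℝ) + -1 * γ * kh = kv - γ * kh by ring] at hkv
    rw [mul_comm, Real.smoothTransition.zero_of_nonpos (div_nonpos_of_nonpos_of_nonneg (by linarith) (mul_pos hεa hL₀).le),
      zero_mul]

/-! ## The envelope symbol `g^env` -/

/-- `0 ≤ g^env`. [folklore] -/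
theorem symEnv_nonneg (R w : ℝ) (ka kc : ℤ) :
    0 ≤ (1 - smoothTransition ((|(ka : ℝ)| - R) / w)) * (1 - smoothTransition ((|(kc : ℝ)| - R) / w)) :=
  mul_nonneg (one_sub_smoothTransition_nonneg _) (one_sub_smoothTransition_nonneg _)

/-- `g^env ≤ 1`. [folklore] -/
theorem symEnv_le_one (R w : ℝ) (ka kc : ℤ) :
    (1 - smoothTransition ((|(ka : ℝ)| - R) / w)) * (1 - smoothTransition ((|(kc : ℝ)| - R) / w)) ≤ 1 :=
  mul_le_one₀ (one_sub_smoothTransition_le_one _) (one_sub_smoothTransition_nonneg _) (one_sub_smoothTransition_le_one _)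

/-- **Support of `g^env`** (hypothesis `hg_supp` of `compat_env` with radius `R + w`): `g^env(k) ≠ 0 ⇒ |k_a| < R + w` and
`|k_c| < R + w` (`w > 0`). [cite: ElgindiLissMattingly2025, §1.2.2 (the cocycle A(r,s))] -/
theorem symEnv_supp {R w : ℝ} (hw : 0 < w) (ka kc : ℤ)
    (h : (1 - smoothTransition ((|(ka : ℝ)| - R) / w)) * (1 - smoothTransition ((|(kc : ℝ)| - R) / w)) ≠ 0) :
    |(ka : ℝ)| < R + w ∧ |(kc : ℝ)| < R + w := by
  obtain ⟨h1, h2⟩ := mul_ne_zero_iff.mp h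
  have h3 := lt_one_of_smoothTransition_ne_one (sub_ne_zero.mp h1).symm
  have h4 := lt_one_of_smoothTransition_ne_one (sub_ne_zero.mp h2).symm
  rw [div_lt_one hw] at h3 h4
  constructor <;> linarith

/-- **`g^env = 1` on the inner ball** (hypothesis `hg'_one` of `compat_env` with radius `R`): `|k_a| ≤ R` and `|k_c| ≤ R`
give `g^env(k) = 1`; in particular on the OPEN ball of radius `R`. [cite: ElgindiLissMattingly2025, §1.2.2 (the cocycle A(r,s))] -/
theorem symEnv_eq_one {R w : ℝ} (hw : 0 < w) (ka kc : ℤ) (hka : |(ka : ℝ)| ≤ R) (hkc : |(kc : ℝ)| ≤ R) :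
    (1 - smoothTransition ((|(ka : ℝ)| - R) / w)) * (1 - smoothTransition ((|(kc : ℝ)| - R) / w)) = 1 := by
  rw [Real.smoothTransition.zero_of_nonpos (div_nonpos_of_nonpos_of_nonneg (by linarith) hw.le),
    Real.smoothTransition.zero_of_nonpos (div_nonpos_of_nonpos_of_nonneg (by linarith) hw.le)]
  ring

end Summit.AnomalousDissipation.AnomalousDissipation.Theorems.SawtoothPulseCascade.K1Symbol
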